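import Summits.Ventures.HSemireg.WedgeHankelRecurrenceGaussChebyshevTGcd
import Mathlib.NumberTheory.Padics.PadicVal.Basic

/-!
# Venture HSemireg — **COPRIMALITY OF `T_m` AND `T_n`, SETTLED: `IsCoprime T_m T_n ⟺ ¬(m ∕ gcd odd ∧ n ∕ gcd odd) ⟺ (m = 0 ∨ n = 0 ∨ v₂(m) ≠ v₂(n))`** over every domain with `2 ≠ 0`
# (the `⇐` half over ANY commutative ring), with the 2-adic reformulation of the parity condition, the resultant form **`Res_{(m,n)}(T_m, T_n) = 0 ⟺ m ∕ gcd, n ∕ gcd odd`** over `ℤ`, and the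
# node form «the `m`- and `n`-point first-kind Gauss–Chebyshev rules share a node iff `m ∕ gcd`, `n ∕ gcd` are odd» (the converse of N455)

HONEST FRAMING. Part of the Lean index of the computation cell `pub-hsemireg` (seat p10 gen 48, Sunday typer «UNIFORM-IN-n»).  Polynomial ∕ ideal algebra, `ℕ`-parity and `padicValNat`
bookkeeping, one real cosine; no variety, no cohomology theory, no sheaf, no Ext group and no semiregularity map is constructed here; nothing here says that HC / HC_CM / HC_AV holds; no Literature
fact (unproved `Prop`) is declared or used.  Custodian versions as in `WedgeHankelSiegelIdeal` (1/3).
SOURCES (cited).  M. O. Rayes, V. Trevisan, P. S. Wang, *Factorization properties of Chebyshev polynomials*, Comput. Math. Appl. 50 (2005) 1231–1240, Thm 4; K. Dilcher, K. B. Stolarsky, *Resultants and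
discriminants of Chebyshev and related polynomials*, Trans. Amer. Math. Soc. 357 (2005) 965–981, Thm 2 (vanishing locus of `Res(T_m, T_n)`); T. J. Rivlin, *Chebyshev Polynomials* (1990), Ex. 1.5.
PROOF TYPED HERE.  N458 `chebyshevT_span_pair_eq_top ∕ _eq_span_gcd`; N455 `chebyshevT_common_real_zero_odd_mul`; Mathlib `Ideal.eq_top_iff_one`, `Ideal.mem_span_pair`, `Ideal.span_singleton_eq_top`,
`Polynomial.natDegree_eq_zero_of_isUnit`, `natDegree_T`, `resultant_map_map`, `resultant_eq_zero_iff`, `padicValNat.mul`, `one_le_padicValNat_of_dvd`, `dvd_of_one_le_padicValNat`,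
`Nat.coprime_div_gcd_div_gcd`.
DEDUP DISCLOSURE (`rg -n 'span_pair_eq_top_iff_isCoprime|chebyshevT_isCoprime_of|chebyshevT_not_isCoprime_of|chebyshevT_isCoprime_iff|odd_div_gcd_iff_padicValNat|chebyshevT_resultant_eq_zero_iff|
chebyshevT_common_real_zero_iff' Summits Literature HarnessLib`, 2026-09-04): N450 `chebyshevT_isCoprime_gap_two_iff` ∕ `chebyshevT_isCoprime_X_iff` (special pairs), N455 (one direction), N454 (the
`U` resultant iff); 0 hits for the 9 names below.

WHAT IS IN THE TREE.  N450, N454, N455, N457, N458.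
THIS FILE (namespace `Summit.Ventures.HSemireg.Wedge.HankelOuter` continued; CHAINED on N458; 0 definitions):
* §1224 `span_pair_eq_top_iff_isCoprime`, **`chebyshevT_isCoprime_of_not_odd_odd`** (any commutative ring), `chebyshevT_isCoprime_of_even_of_odd`, **`chebyshevT_not_isCoprime_of_odd_odd`**,
  **`chebyshevT_isCoprime_iff`** (domains with `2 ≠ 0`), `odd_div_gcd_iff_padicValNat_eq`, **`chebyshevT_isCoprime_iff_padicValNat_ne`**, **`chebyshevT_resultant_eq_zero_iff`** (`ℤ`),
  **`chebyshevT_common_real_zero_iff`**.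
CAVEATS.  `ℕ`-division conventions as in N458.  Nothing Ext-side.  New names only.
-/

open Module Polynomial Real
open scoped Matrix Polynomial

namespace Summit.Ventures.HSemireg.Wedge.HankelOuter

/-! ## §1224. `IsCoprime T_m T_n` settled -/

/-- Ideal bookkeeping: `(x, y) = (1) ⟺ x, y` coprime. [this file, §1224] -/
theorem span_pair_eq_top_iff_isCoprime {A : Type*} [CommRing A] (x y : A) : Ideal.span {x, y} = ⊤ ↔ IsCoprime x y := by
  rw [Ideal.eq_top_iff_one, Ideal.mem_span_pair]
  exact Iff.rfl

/-- **`T_m`, `T_n` are coprime in `R[X]` for EVERY commutative ring `R` unless `m ∕ gcd(m,n)` and `n ∕ gcd(m,n)` are both odd.** [Rayes–Trevisan–Wang 2005 Thm 4; this file, §1224] -/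
theorem chebyshevT_isCoprime_of_not_odd_odd {R : Type*} [CommRing R] {m n : ℕ} (h : ¬ (Odd (m / Nat.gcd m n) ∧ Odd (n / Nat.gcd m n))) :
    IsCoprime (Polynomial.Chebyshev.T R (m : ℤ)) (Polynomial.Chebyshev.T R (n : ℤ)) :=
  (span_pair_eq_top_iff_isCoprime _ _).1 (chebyshevT_span_pair_eq_top h)

/-- **`m` even, `n` odd ⇒ `T_m`, `T_n` coprime** (any commutative ring). [this file, §1224] -/
theorem chebyshevT_isCoprime_of_even_of_odd {R : Type*} [CommRing R] {m n : ℕ} (hm : Even m) (hn : Odd n) :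
    IsCoprime (Polynomial.Chebyshev.T R (m : ℤ)) (Polynomial.Chebyshev.T R (n : ℤ)) := by
  refine chebyshevT_isCoprime_of_not_odd_odd fun h => ?_
  have hg : Odd (Nat.gcd m n) := Odd.of_dvd_nat hn (Nat.gcd_dvd_right m n)
  have hm' : Odd m := by
    rw [← Nat.div_mul_cancel (Nat.gcd_dvd_left m n)]
    exact h.1.mul hg
  exact (Nat.not_even_iff_odd.2 hm') hm

/-- **`m ∕ gcd`, `n ∕ gcd` both odd ⇒ `T_m`, `T_n` are NOT coprime** over a domain with `2 ≠ 0` (`(T_m, T_n) = (T_{gcd})`, `deg T_{gcd} = gcd ≥ 1`). [this file, §1224] -/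
theorem chebyshevT_not_isCoprime_of_odd_odd {R : Type*} [CommRing R] [IsDomain R] [NeZero (2 : R)] {m n : ℕ} (h : Odd (m / Nat.gcd m n) ∧ Odd (n / Nat.gcd m n)) :
    ¬ IsCoprime (Polynomial.Chebyshev.T R (m : ℤ)) (Polynomial.Chebyshev.T R (n : ℤ)) := by
  intro hc
  have hg : Nat.gcd m n ≠ 0 := by
    intro h0
    rw [h0, Nat.div_zero] at h
    exact Nat.not_odd_zero h.1
  have htop := (span_pair_eq_top_iff_isCoprime _ _).2 hc
  rw [chebyshevT_span_pair_eq_span_gcd h, Ideal.span_singleton_eq_top] at htop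
  have hdeg := Polynomial.natDegree_eq_zero_of_isUnit htop
  rw [Polynomial.Chebyshev.natDegree_T, Int.natAbs_natCast] at hdeg
  exact hg hdeg

/-- **`IsCoprime T_m T_n ⟺ ¬(m ∕ gcd odd ∧ n ∕ gcd odd)`** over every domain with `2 ≠ 0`. [Rayes–Trevisan–Wang 2005 Thm 4; this file, §1224] -/
theorem chebyshevT_isCoprime_iff {R : Type*} [CommRing R] [IsDomain R] [NeZero (2 : R)] (m n : ℕ) :
    IsCoprime (Polynomial.Chebyshev.T R (m : ℤ)) (Polynomial.Chebyshev.T R (n : ℤ)) ↔ ¬ (Odd (m / Nat.gcd m n) ∧ Odd (n / Nat.gcd m n)) :=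
  ⟨fun hc h => chebyshevT_not_isCoprime_of_odd_odd h hc, chebyshevT_isCoprime_of_not_odd_odd⟩

/-- **2-adic reformulation: for `m, n ≠ 0`, `m ∕ gcd` and `n ∕ gcd` are both odd iff `v₂(m) = v₂(n)`.** [bookkeeping; this file, §1224] -/
theorem odd_div_gcd_iff_padicValNat_eq {m n : ℕ} (hm : m ≠ 0) (hn : n ≠ 0) :
    (Odd (m / Nat.gcd m n) ∧ Odd (n / Nat.gcd m n)) ↔ padicValNat 2 m = padicValNat 2 n := by
  have hg0 : Nat.gcd m n ≠ 0 := Nat.gcd_ne_zero_left hm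
  have ha0 : m / Nat.gcd m n ≠ 0 := (Nat.div_pos (Nat.gcd_le_left n (Nat.pos_of_ne_zero hm)) (Nat.pos_of_ne_zero hg0)).ne'
  have hb0 : n / Nat.gcd m n ≠ 0 := (Nat.div_pos (Nat.gcd_le_right m (Nat.pos_of_ne_zero hn)) (Nat.pos_of_ne_zero hg0)).ne'
  have hcop : Nat.Coprime (m / Nat.gcd m n) (n / Nat.gcd m n) := Nat.coprime_div_gcd_div_gcd (Nat.pos_of_ne_zero hg0)
  have hvm : padicValNat 2 m = padicValNat 2 (Nat.gcd m n) + padicValNat 2 (m / Nat.gcd m n) := by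
    conv_lhs => rw [← Nat.mul_div_cancel' (Nat.gcd_dvd_left m n)]
    exact padicValNat.mul hg0 ha0
  have hvn : padicValNat 2 n = padicValNat 2 (Nat.gcd m n) + padicValNat 2 (n / Nat.gcd m n) := by
    conv_lhs => rw [← Nat.mul_div_cancel' (Nat.gcd_dvd_right m n)]
    exact padicValNat.mul hg0 hb0
  rw [hvm, hvn, Nat.add_left_cancel_iff]
  -- coprime `a`, `b`: `v₂(a) = v₂(b)` iff both odd
  have key : ∀ {a b : ℕ}, a ≠ 0 → Nat.Coprime a b → padicValNat 2 a = padicValNat 2 b → Odd a := by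
    intro a b ha hab hv
    by_contra hna
    rw [Nat.not_odd_iff_even, even_iff_two_dvd] at hna
    have h1 : 1 ≤ padicValNat 2 b := hv ▸ one_le_padicValNat_of_dvd ha hna
    have h2 : 2 ∣ Nat.gcd a b := Nat.dvd_gcd hna (dvd_of_one_le_padicValNat h1)
    rw [Nat.Coprime.gcd_eq_one hab] at h2
    exact absurd h2 (by norm_num)
  constructor
  · rintro ⟨ha, hb⟩
    rw [padicValNat.eq_zero_of_not_dvd ha.not_two_dvd_nat, padicValNat.eq_zero_of_not_dvd hb.not_two_dvd_nat]
  · intro hv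
    exact ⟨key ha0 hcop hv, key hb0 hcop.symm hv.symm⟩

/-- **`IsCoprime T_m T_n ⟺ v₂(m) ≠ v₂(n)` for `m, n ≥ 1`** over every domain with `2 ≠ 0`. [Rayes–Trevisan–Wang 2005 Thm 4 (2-adic form); this file, §1224] -/
theorem chebyshevT_isCoprime_iff_padicValNat_ne {R : Type*} [CommRing R] [IsDomain R] [NeZero (2 : R)] {m n : ℕ} (hm : m ≠ 0) (hn : n ≠ 0) :
    IsCoprime (Polynomial.Chebyshev.T R (m : ℤ)) (Polynomial.Chebyshev.T R (n : ℤ)) ↔ padicValNat 2 m ≠ padicValNat 2 n := by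
  rw [chebyshevT_isCoprime_iff, odd_div_gcd_iff_padicValNat_eq hm hn]

/-- **`Res_{(m,n)}(T_m, T_n) = 0 ⟺ m ∕ gcd, n ∕ gcd both odd`** (integer resultant of Mathlib's `T`). [Dilcher–Stolarsky 2005 Thm 2 (vanishing locus); this file, §1224] -/
theorem chebyshevT_resultant_eq_zero_iff (m n : ℕ) :
    (Polynomial.Chebyshev.T ℤ (m : ℤ)).resultant (Polynomial.Chebyshev.T ℤ (n : ℤ)) m n = 0 ↔ Odd (m / Nat.gcd m n) ∧ Odd (n / Nat.gcd m n) := by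
  have hmap := Polynomial.resultant_map_map (f := Polynomial.Chebyshev.T ℤ (m : ℤ)) (g := Polynomial.Chebyshev.T ℤ (n : ℤ)) (m := m) (n := n) (Int.castRingHom ℝ)
  rw [Polynomial.Chebyshev.map_T, Polynomial.Chebyshev.map_T] at hmap
  have hdef : (Polynomial.Chebyshev.T ℝ (m : ℤ)).resultant (Polynomial.Chebyshev.T ℝ (n : ℤ)) m n =
      (Polynomial.Chebyshev.T ℝ (m : ℤ)).resultant (Polynomial.Chebyshev.T ℝ (n : ℤ)) := by
    rw [Polynomial.Chebyshev.natDegree_T, Polynomial.Chebyshev.natDegree_T, Int.natAbs_natCast, Int.natAbs_natCast]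
  rw [← Int.cast_eq_zero (α := ℝ), ← eq_intCast (Int.castRingHom ℝ), ← hmap, hdef, Polynomial.resultant_eq_zero_iff,
    chebyshevT_isCoprime_iff (R := ℝ) m n, not_not]
  exact ⟨fun h => h.2, fun h => ⟨Or.inl (Polynomial.Chebyshev.T_ne_zero ℝ _), h⟩⟩

/-- **`T_m` and `T_n` have a common real zero iff `m ∕ gcd`, `n ∕ gcd` are both odd** (then `cos(π ∕ (2 gcd))` is one). [Rivlin Ex. 1.5; Dilcher–Stolarsky 2005; this file, §1224] -/
theorem chebyshevT_common_real_zero_iff (m n : ℕ) :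
    (∃ x : ℝ, (Polynomial.Chebyshev.T ℝ (m : ℤ)).eval x = 0 ∧ (Polynomial.Chebyshev.T ℝ (n : ℤ)).eval x = 0) ↔ Odd (m / Nat.gcd m n) ∧ Odd (n / Nat.gcd m n) := by
  constructor
  · rintro ⟨x, hxm, hxn⟩
    by_contra h
    obtain ⟨u, v, huv⟩ := chebyshevT_isCoprime_of_not_odd_odd (R := ℝ) h
    have e := congrArg (Polynomial.eval x) huv
    rw [eval_add, eval_mul, eval_mul, hxm, hxn, mul_zero, mul_zero, add_zero, eval_one] at e
    exact zero_ne_one e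
  · intro h
    have hg : 1 ≤ Nat.gcd m n := by
      rcases Nat.eq_zero_or_pos (Nat.gcd m n) with h0 | h0
      · rw [h0, Nat.div_zero] at h
        exact absurd h.1 Nat.not_odd_zero
      · exact h0
    have hz := chebyshevT_common_real_zero_odd_mul (Odd.natCast h.1) (Odd.natCast h.2) hg
    rw [← Nat.cast_mul, ← Nat.cast_mul, Nat.div_mul_cancel (Nat.gcd_dvd_left m n), Nat.div_mul_cancel (Nat.gcd_dvd_right m n)] at hz
    exact ⟨_, hz⟩

end Summit.Ventures.HSemireg.Wedge.HankelOuter
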